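import Mathlib.Analysis.Calculus.Deriv.MeanValue
import Mathlib.Analysis.SpecialFunctions.ExpDeriv
import Literature.Analysis.FluidPDE.CompressibleEulerImplosionODEMaximal
import Literature.Analysis.FluidPDE.CompressibleEulerImplosionODEEscape
import Literature.Analysis.FluidPDE.CompressibleEulerImplosionDiagonal
import Literature.Analysis.FluidPDE.CompressibleEulerImplosionTriangle
import HarnessLib

/-!
# Buckmaster–Cao-Labora–Gómez-Serrano at γ = 5/3: the end of the left branch (the wedge at `P_∞`)

The last step of Proposition 3.1 ("the smooth branch through `P_s` reaches `P_∞ = (0,0)`"): the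
wedge `𝒲 = {0 < W ≤ 9/10, −(3/2) W < Z < W}` with vertex at `P_∞` is forward invariant for the
self-similar ODE (1.8) when `11/10 ≤ r ≤ 2`: the diagonal `Z = W` is invariant, the ray
`Z = −(3/2) W` is crossed inwards (`N_Z D_W + (3/2) N_W D_Z = W² (5r/4 − 55/48 − 35 W/144) > 0`),
and `W` decreases (`N_W < 0`). Inside the wedge `D_W, D_Z > 0` and `W′ ≤ −κ W`, so every solution
entering the wedge exists for all later times, stays off the sonic lines with `Z < W`, and tends
to `P_∞` exponentially. This replaces the local analysis at the sink `P_∞` of Prop. 1.6/3.1.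

[cite: BuckmasterCaolaboraGomezserrano2025, Prop. 3.1, Prop. 1.6, §6]
-/

noncomputable section

open Set Filter Topology

namespace Literature.Analysis.FluidPDE

namespace BuckmasterCaolaboraGomezserrano2025

namespace Monatomic

namespace Wedge

variable {r : ℝ}

/-- The wedge at `P_∞` (with top abscissa `WK`). [cite: BuckmasterCaolaboraGomezserrano2025, Prop. 3.1] -/
def InW (WK : ℝ) (p : ℝ × ℝ) : Prop := 0 < p.1 ∧ p.1 ≤ WK ∧ -(3 / 2) * p.1 < p.2 ∧ p.2 < p.1

/-! ### Pointwise estimates in the wedge -/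

/-- [folklore] -/
theorem DW_bounds {WK : ℝ} (hWK : WK ≤ 9 / 10) {p : ℝ × ℝ} (h : InW WK p) :
    1 ≤ DW p.1 p.2 ∧ DW p.1 p.2 ≤ 2 := by
  obtain ⟨h1, h2, h3, h4⟩ := h
  unfold DW; constructor <;> linarith

/-- [folklore] -/
theorem DZ_pos {WK : ℝ} (hWK : WK ≤ 9 / 10) {p : ℝ × ℝ} (h : InW WK p) : 2 / 5 ≤ DZ p.1 p.2 := by
  obtain ⟨h1, h2, h3, h4⟩ := h
  unfold DZ; linarith

/-- `N_W ≤ −(r − 1/24) W < 0` in the wedge. [folklore] -/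
theorem NW_le {WK : ℝ} (hWK : WK ≤ 9 / 10) (hr : 1 ≤ r) {p : ℝ × ℝ} (h : InW WK p) :
    NW r p.1 p.2 ≤ -(r - 1 / 24) * p.1 ∧ NW r p.1 p.2 < 0 := by
  obtain ⟨h1, h2, h3, h4⟩ := h
  have hZ2 : p.2 ^ 2 ≤ 9 / 4 * p.1 ^ 2 := by nlinarith
  have hWZ : -(p.1 * p.2) ≤ 3 / 2 * p.1 ^ 2 := by nlinarith
  have key : NW r p.1 p.2 ≤ -(r - 1 / 24) * p.1 := by unfold NW; nlinarith
  exact ⟨key, by nlinarith⟩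

/-- `N_W ≥ −(r + 7/6) W` in the wedge. [folklore] -/
theorem NW_ge {WK : ℝ} (hWK : WK ≤ 9 / 10) {p : ℝ × ℝ} (h : InW WK p) :
    -(r + 7 / 6) * p.1 ≤ NW r p.1 p.2 := by
  obtain ⟨h1, h2, h3, h4⟩ := h
  have hWZ : p.1 * p.2 ≤ p.1 ^ 2 := by nlinarith
  have hW2 : p.1 ^ 2 ≤ p.1 := by nlinarith
  unfold NW; nlinarith [sq_nonneg p.2]

/-- `W′ ≤ −κ W` in the wedge, `κ = (r − 1/24)/2`. [folklore] -/
theorem field_fst_le {WK : ℝ} (hWK : WK ≤ 9 / 10) (hr : 1 ≤ r) {p : ℝ × ℝ} (h : InW WK p) :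
    (field r p).1 ≤ -((r - 1 / 24) / 2) * p.1 := by
  obtain ⟨hD1, hD2⟩ := DW_bounds hWK h
  obtain ⟨hN, hNneg⟩ := NW_le hWK hr h
  show NW r p.1 p.2 / DW p.1 p.2 ≤ _
  rw [div_le_iff₀ (by linarith)]
  have := h.1
  nlinarith

/-- `W′ ≥ −(r + 7/6) W` in the wedge. [folklore] -/
theorem field_fst_ge {WK : ℝ} (hWK : WK ≤ 9 / 10) (hr : 1 ≤ r) {p : ℝ × ℝ} (h : InW WK p) :
    -(r + 7 / 6) * p.1 ≤ (field r p).1 := by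
  obtain ⟨hD1, hD2⟩ := DW_bounds hWK h
  have hN := NW_ge (r := r) hWK h
  have hW := h.1
  show _ ≤ NW r p.1 p.2 / DW p.1 p.2
  rw [le_div_iff₀ (by linarith)]
  nlinarith [mul_nonneg (by positivity : 0 ≤ (r + 7 / 6) * p.1) (by linarith : 0 ≤ DW p.1 p.2 - 1)]

/-- `W′ < 0` in the wedge. [folklore] -/
theorem field_fst_neg {WK : ℝ} (hWK : WK ≤ 9 / 10) (hr : 1 ≤ r) {p : ℝ × ℝ} (h : InW WK p) :
    (field r p).1 < 0 := by
  have := field_fst_le hWK hr h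
  have hW := h.1
  nlinarith

/-- **The ray `Z = −(3/2) W` is crossed inwards**: `N_Z D_W + (3/2) N_W D_Z = W²(5r/4 − 55/48 − 35W/144) > 0`
for `0 < W ≤ 9/10`, `r ≥ 11/10`. [cite: BuckmasterCaolaboraGomezserrano2025, Prop. 3.1] -/
theorem ray_cross (hr : 11 / 10 ≤ r) {W : ℝ} (hW : 0 < W) (hW1 : W ≤ 9 / 10) :
    0 < NZ r W (-(3 / 2) * W) * DW W (-(3 / 2) * W) + 3 / 2 * (NW r W (-(3 / 2) * W) * DZ W (-(3 / 2) * W)) := by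
  have e : NZ r W (-(3 / 2) * W) * DW W (-(3 / 2) * W) + 3 / 2 * (NW r W (-(3 / 2) * W) * DZ W (-(3 / 2) * W))
      = W ^ 2 * (5 * r / 4 - 55 / 48 - 35 * W / 144) := by
    unfold NZ NW DW DZ; ring
  rw [e]
  have : 0 < 5 * r / 4 - 55 / 48 - 35 * W / 144 := by linarith
  positivity

/-! ### The components of a solution -/

/-- [folklore] -/
theorem hasDerivAt_fst {c : ℝ → ℝ × ℝ} {v : ℝ × ℝ} {t : ℝ} (hc : HasDerivAt c v t) :
    HasDerivAt (fun s => (c s).1) v.1 t := hc.fst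

/-- [folklore] -/
theorem hasDerivAt_snd {c : ℝ → ℝ × ℝ} {v : ℝ × ℝ} {t : ℝ} (hc : HasDerivAt c v t) :
    HasDerivAt (fun s => (c s).2) v.2 t := hc.snd

/-- `Z < W` is preserved along solutions off the sonic lines. [cite: BuckmasterCaolaboraGomezserrano2025, Prop. 3.1] -/
theorem snd_lt_fst_of_solution {c : ℝ → ℝ × ℝ} {a T t₀ : ℝ}
    (hc : ∀ t ∈ Ioo a T, HasDerivAt c (field r (c t)) t)
    (hU : ∀ t ∈ Ioo a T, DW (c t).1 (c t).2 ≠ 0 ∧ DZ (c t).1 (c t).2 ≠ 0)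
    (ht₀ : t₀ ∈ Ioo a T) (h0 : (c t₀).2 < (c t₀).1) : ∀ t ∈ Ioo a T, (c t).2 < (c t).1 :=
  sub_pos_of_exists (W := fun t => (c t).1) (Z := fun t => (c t).2)
    (W' := fun t => (field r (c t)).1) (Z' := fun t => (field r (c t)).2) isOpen_Ioo ordConnected_Ioo
    (fun t ht => hasDerivAt_fst (hc t ht)) (fun t ht => hasDerivAt_snd (hc t ht))
    (fun t ht => (hU t ht).1) (fun t ht => (hU t ht).2)
    (fun t ht => by show DW _ _ * (NW r _ _ / DW _ _) = _; field_simp [(hU t ht).1])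
    (fun t ht => by show DZ _ _ * (NZ r _ _ / DZ _ _) = _; field_simp [(hU t ht).2])
    ht₀ h0

/-! ### Forward invariance of the wedge -/

/-- **The wedge is forward invariant.** [cite: BuckmasterCaolaboraGomezserrano2025, Prop. 3.1] -/
theorem inW_of_solution (hr : 11 / 10 ≤ r) {WK : ℝ} (hWK : WK ≤ 9 / 10) {c : ℝ → ℝ × ℝ}
    {a T t₀ : ℝ} (ha : a < t₀)
    (hc : ∀ t ∈ Ioo a T, HasDerivAt c (field r (c t)) t)
    (hU : ∀ t ∈ Ioo a T, DW (c t).1 (c t).2 ≠ 0 ∧ DZ (c t).1 (c t).2 ≠ 0)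
    (h0 : InW WK (c t₀)) : ∀ t ∈ Ico t₀ T, InW WK (c t) := by
  intro t ht
  have hr1 : 1 ≤ r := by linarith
  have ht₀T : t₀ < T := lt_of_le_of_lt ht.1 ht.2
  have hdiag := snd_lt_fst_of_solution hc hU ⟨ha, ht₀T⟩ h0.2.2.2
  -- three barrier constraints: the ray, a decaying positive lower bound for `W`, and `W ≤ WK`
  set C : ℝ := r + 7 / 6 + 1 with hC
  set wlo : ℝ := (c t₀).1 / 2 with hwlo
  have hwlo0 : 0 < wlo := by have := h0.1; positivity
  set g : Fin 3 → ℝ → ℝ := fun i => match i with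
    | 0 => fun s => -(3 / 2) * (c s).1 - (c s).2
    | 1 => fun s => wlo * Real.exp (-C * (s - t₀)) - (c s).1
    | 2 => fun s => (c s).1 - WK with hg
  set g' : Fin 3 → ℝ → ℝ := fun i => match i with
    | 0 => fun s => -(3 / 2) * (field r (c s)).1 - (field r (c s)).2
    | 1 => fun s => wlo * (Real.exp (-C * (s - t₀)) * (-C)) - (field r (c s)).1
    | 2 => fun s => (field r (c s)).1 with hg'
  have hexp : ∀ s, HasDerivAt (fun s => Real.exp (-C * (s - t₀))) (Real.exp (-C * (s - t₀)) * (-C)) s := by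
    intro s
    have h1 : HasDerivAt (fun s => -C * (s - t₀)) (-C) s := by
      simpa using ((hasDerivAt_id s).sub_const t₀).const_mul (-C)
    exact h1.exp
  have hgd : ∀ i, ∀ ξ ∈ Ico t₀ T, HasDerivAt (g i) (g' i ξ) ξ := by
    intro i ξ hξ
    have hcξ := hc ξ ⟨by linarith [hξ.1], hξ.2⟩
    fin_cases i
    · exact ((hasDerivAt_fst hcξ).const_mul _).sub (hasDerivAt_snd hcξ)
    · exact ((hexp ξ).const_mul wlo).sub (hasDerivAt_fst hcξ)
    · exact (hasDerivAt_fst hcξ).sub_const _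
  have hg0 : ∀ i, g i t₀ ≤ 0 := by
    intro i
    obtain ⟨k1, k2, k3, k4⟩ := h0
    fin_cases i
    · show -(3 / 2) * (c t₀).1 - (c t₀).2 ≤ 0; linarith
    · show wlo * Real.exp (-C * (t₀ - t₀)) - (c t₀).1 ≤ 0
      rw [sub_self, mul_zero, Real.exp_zero, mul_one]; simp only [hwlo]; linarith
    · show (c t₀).1 - WK ≤ 0; linarith
  have hkey : ∀ ξ ∈ Ico t₀ T, (∀ j, g j ξ ≤ 0) → ∀ i, g i ξ = 0 → g' i ξ < 0 := by
    intro ξ hξ hall i hi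
    have hZW := hdiag ξ ⟨by linarith [hξ.1], hξ.2⟩
    have k0 : -(3 / 2) * (c ξ).1 - (c ξ).2 ≤ 0 := hall 0
    have k1 : wlo * Real.exp (-C * (ξ - t₀)) - (c ξ).1 ≤ 0 := hall 1
    have k2 : (c ξ).1 - WK ≤ 0 := hall 2
    have hWpos : 0 < (c ξ).1 := by
      have := Real.exp_pos (-C * (ξ - t₀)); nlinarith
    -- the closed wedge point is off the sonic lines with the wedge estimates
    have hDW : 1 ≤ DW (c ξ).1 (c ξ).2 := by unfold DW; linarith
    have hDW2 : DW (c ξ).1 (c ξ).2 ≤ 2 := by unfold DW; linarith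
    have hDZ : 2 / 5 ≤ DZ (c ξ).1 (c ξ).2 := by unfold DZ; linarith
    have hNWge : -(r + 7 / 6) * (c ξ).1 ≤ NW r (c ξ).1 (c ξ).2 := by
      have hWZ : (c ξ).1 * (c ξ).2 ≤ (c ξ).1 ^ 2 := by nlinarith
      have hW2 : (c ξ).1 ^ 2 ≤ (c ξ).1 := by nlinarith
      unfold NW; nlinarith [sq_nonneg (c ξ).2]
    have hNWle : NW r (c ξ).1 (c ξ).2 < 0 := by
      have hZ2 : (c ξ).2 ^ 2 ≤ 9 / 4 * (c ξ).1 ^ 2 := by nlinarith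
      have hWZ : -((c ξ).1 * (c ξ).2) ≤ 3 / 2 * (c ξ).1 ^ 2 := by nlinarith
      unfold NW; nlinarith
    have hW'lo : -(r + 7 / 6) * (c ξ).1 ≤ (field r (c ξ)).1 := by
      show _ ≤ NW r (c ξ).1 (c ξ).2 / DW (c ξ).1 (c ξ).2
      rw [le_div_iff₀ (by linarith)]
      nlinarith [mul_nonneg (by positivity : 0 ≤ (r + 7 / 6) * (c ξ).1) (by linarith : 0 ≤ DW (c ξ).1 (c ξ).2 - 1)]
    have hW'neg : (field r (c ξ)).1 < 0 := by
      show NW r (c ξ).1 (c ξ).2 / DW (c ξ).1 (c ξ).2 < 0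
      exact div_neg_of_neg_of_pos hNWle (by linarith)
    fin_cases i
    · -- on the ray: inward crossing
      have hZ : (c ξ).2 = -(3 / 2) * (c ξ).1 := by
        have : -(3 / 2) * (c ξ).1 - (c ξ).2 = 0 := hi
        linarith
      have hray := ray_cross hr hWpos (by linarith)
      have hDWne : DW (c ξ).1 (c ξ).2 ≠ 0 := by linarith
      have hDZne : DZ (c ξ).1 (c ξ).2 ≠ 0 := by linarith
      show -(3 / 2) * (field r (c ξ)).1 - (field r (c ξ)).2 < 0
      have e : -(3 / 2) * (field r (c ξ)).1 - (field r (c ξ)).2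
          = -((NZ r (c ξ).1 (c ξ).2 * DW (c ξ).1 (c ξ).2
              + 3 / 2 * (NW r (c ξ).1 (c ξ).2 * DZ (c ξ).1 (c ξ).2))
              / (DW (c ξ).1 (c ξ).2 * DZ (c ξ).1 (c ξ).2)) := by
        unfold field; field_simp; ring
      rw [e, neg_lt_zero]
      apply div_pos _ (by positivity)
      rw [hZ]
      exact hray
    · -- the decaying lower bound for `W`
      have hW : (c ξ).1 = wlo * Real.exp (-C * (ξ - t₀)) := by
        have : wlo * Real.exp (-C * (ξ - t₀)) - (c ξ).1 = 0 := hi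
        linarith
      show wlo * (Real.exp (-C * (ξ - t₀)) * (-C)) - (field r (c ξ)).1 < 0
      have : wlo * (Real.exp (-C * (ξ - t₀)) * (-C)) = -C * (c ξ).1 := by rw [hW]; ring
      rw [this]
      simp only [hC]
      nlinarith
    · -- `W ≤ WK`
      exact hW'neg
  have hall := ODE.forall_le_zero_of_deriv_neg hgd hg0 hkey t ht
  have k0 : -(3 / 2) * (c t).1 - (c t).2 ≤ 0 := hall 0
  have k1 : wlo * Real.exp (-C * (t - t₀)) - (c t).1 ≤ 0 := hall 1
  have k2 : (c t).1 - WK ≤ 0 := hall 2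
  have hZW := hdiag t ⟨by linarith [ht.1], ht.2⟩
  have hWpos : 0 < (c t).1 := by have := Real.exp_pos (-C * (t - t₀)); nlinarith
  refine ⟨hWpos, by linarith, ?_, hZW⟩
  -- strictness of the ray constraint: rerun the argument from a slightly lowered ray? No:
  -- if `Z = −(3/2)W` at `t > t₀`, the constraint function has negative derivative there while
  -- being `≤ 0` before, which is impossible; at `t = t₀` strictness is the hypothesis.
  rcases eq_or_lt_of_le k0 with heq | hlt
  · exfalso
    rcases eq_or_lt_of_le ht.1 with h0t | h0t
    · rw [← h0t] at heq; have := h0.2.2.1; linarith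
    · -- derivative of `g 0` at `t` is negative, but `g 0 ≤ 0 = g 0 t` on `[t₀, t)`
      have hd : HasDerivAt (g 0) (g' 0 t) t := hgd 0 t ht
      have hneg : g' 0 t < 0 := hkey t ht hall 0 (by show -(3 / 2) * (c t).1 - (c t).2 = 0; linarith)
      -- slope from the left is ≥ 0
      have hsl : Tendsto (slope (g 0) t) (𝓝[≠] t) (𝓝 (g' 0 t)) := hasDerivAt_iff_tendsto_slope.mp hd
      have h1 : ∀ᶠ y in 𝓝[<] t, slope (g 0) t y < 0 :=
        ((tendsto_order.1 hsl).2 0 hneg).filter_mono (nhdsWithin_mono t fun y hy => ne_of_lt hy)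
      have h2 : ∀ᶠ y in 𝓝[<] t, t₀ < y := by
        exact mem_nhdsWithin_of_mem_nhds (Ioi_mem_nhds h0t)
      have h3 : ∀ᶠ y in 𝓝[<] t, y < t := eventually_mem_nhdsWithin
      obtain ⟨y, hy1, hy2, hy3⟩ := (h1.and (h2.and h3)).exists
      have hgy : g 0 y ≤ 0 := ODE.forall_le_zero_of_deriv_neg hgd hg0 hkey y ⟨hy2.le, hy3.trans ht.2⟩ 0
      have hgt : g 0 t = 0 := by show -(3 / 2) * (c t).1 - (c t).2 = 0; linarith
      rw [slope_def_field, hgt] at hy1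
      have hyt : y - t < 0 := by linarith
      have : 0 < g 0 y - 0 := by
        by_contra hcon
        have hcon' : g 0 y - 0 ≤ 0 := not_lt.mp hcon
        have := div_nonneg_of_nonpos hcon' hyt.le
        linarith
      linarith
  · linarith

/-! ### Global existence and convergence to `P_∞` -/

/-- The closed wedge (a compact triangle off the sonic lines). [folklore] -/
def Kc : Set (ℝ × ℝ) := {p | 0 ≤ p.1 ∧ p.1 ≤ 9 / 10 ∧ -(3 / 2) * p.1 ≤ p.2 ∧ p.2 ≤ p.1}

/-- [folklore] -/
theorem isCompact_Kc : IsCompact Kc := by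
  have hclosed : IsClosed Kc := by
    have e : Kc = (fun p : ℝ × ℝ => p.1) ⁻¹' Icc 0 (9 / 10) ∩
        ((fun p : ℝ × ℝ => -(3 / 2) * p.1 - p.2) ⁻¹' Iic 0 ∩ (fun p : ℝ × ℝ => p.2 - p.1) ⁻¹' Iic 0) := by
      ext p; simp only [Kc, mem_setOf_eq, mem_inter_iff, mem_preimage, mem_Icc, mem_Iic]
      constructor
      · rintro ⟨h1, h2, h3, h4⟩; exact ⟨⟨h1, h2⟩, by linarith, by linarith⟩
      · rintro ⟨⟨h1, h2⟩, h3, h4⟩; exact ⟨h1, h2, by linarith, by linarith⟩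
    rw [e]
    exact (isClosed_Icc.preimage continuous_fst).inter
      ((isClosed_Iic.preimage ((continuous_const.mul continuous_fst).sub continuous_snd)).inter
        (isClosed_Iic.preimage (continuous_snd.sub continuous_fst)))
  refine (isCompact_closedBall (0 : ℝ × ℝ) 2).of_isClosed_subset hclosed fun p hp => ?_
  obtain ⟨h1, h2, h3, h4⟩ := hp
  rw [Metric.mem_closedBall, dist_zero_right, Prod.norm_def, Real.norm_eq_abs, Real.norm_eq_abs]
  exact max_le (abs_le.mpr ⟨by linarith, by linarith⟩) (abs_le.mpr ⟨by linarith, by linarith⟩)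

/-- [folklore] -/
theorem Kc_subset_offSonic : Kc ⊆ offSonic := fun p hp => by
  obtain ⟨h1, h2, h3, h4⟩ := hp
  constructor
  · show DW p.1 p.2 ≠ 0; unfold DW; intro h; linarith
  · show DZ p.1 p.2 ≠ 0; unfold DZ; intro h; linarith

/-- [folklore] -/
theorem mem_Kc_of_inW {WK : ℝ} (hWK : WK ≤ 9 / 10) {p : ℝ × ℝ} (h : InW WK p) : p ∈ Kc :=
  ⟨h.1.le, h.2.1.trans hWK, h.2.2.1.le, h.2.2.2.le⟩

/-- **Global continuation in the wedge and convergence to `P_∞`.** A solution of (1.8) can be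
started at any point of the wedge; it exists for all later times, stays in the wedge (so
`D_W, D_Z > 0` and `Z < W`), its abscissa decays like `e^{−κ t}`, and it tends to `P_∞ = (0,0)`.
[cite: BuckmasterCaolaboraGomezserrano2025, Prop. 3.1] -/
theorem wedge_global (hr : 11 / 10 ≤ r) {WK : ℝ} (hWK : WK ≤ 9 / 10) {p₀ : ℝ × ℝ}
    (h0 : InW WK p₀) (t₀ : ℝ) :
    ∃ c : ℝ → ℝ × ℝ, c t₀ = p₀ ∧ (∀ t, t₀ ≤ t → HasDerivAt c (field r (c t)) t) ∧
      (∀ t, t₀ ≤ t → InW WK (c t)) ∧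
      (∀ t, t₀ ≤ t → 0 < DW (c t).1 (c t).2 ∧ 0 < DZ (c t).1 (c t).2) ∧
      (∀ t, t₀ ≤ t → (c t).1 ≤ p₀.1 * Real.exp (-((r - 1 / 24) / 2) * (t - t₀))) ∧
      Tendsto c atTop (𝓝 0) := by
  have hr1 : 1 ≤ r := by linarith
  have hF : ∀ x ∈ offSonic, ContDiffAt ℝ 1 (field r) x := fun x hx => contDiffAt_field_of_mem hx
  have hp₀ : p₀ ∈ offSonic := Kc_subset_offSonic (mem_Kc_of_inW hWK h0)
  obtain ⟨α, ε, hε, hα0, hα, hαU⟩ := ODE.exists_solution_mem isOpen_offSonic hF hp₀ t₀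
  have haT : t₀ - ε < t₀ + ε := by linarith
  -- the maximal continuation is global
  have hglob : ∃ c : ℝ → ℝ × ℝ, c t₀ = p₀ ∧ (∀ t ∈ Ioi (t₀ - ε), HasDerivAt c (field r (c t)) t) ∧
      ∀ t ∈ Ioi (t₀ - ε), c t ∈ offSonic := by
    rcases ODE.exists_maximal hF haT hα hαU with ⟨c, heq, hc, hcU⟩ | ⟨T, hT, c, heq, hc, hcU, hmax⟩
    · exact ⟨c, by rw [heq ⟨by linarith, by linarith⟩, hα0], hc, hcU⟩
    · exfalso
      have hc0 : c t₀ = p₀ := by rw [heq ⟨by linarith, by linarith⟩, hα0]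
      have hinv := inW_of_solution hr hWK (c := c) (a := t₀ - ε) (T := T) (t₀ := t₀) (by linarith) hc
        (fun t ht => hcU t ht) (by rw [hc0]; exact h0)
      obtain ⟨δ, hδ, hout⟩ := ODE.eventually_not_mem_of_maximal isOpen_offSonic hF isCompact_Kc
        Kc_subset_offSonic hc hcU hmax
      have ht₀T : t₀ < T := by linarith
      set t := max t₀ (T - δ / 2) with ht
      have ht1 : t₀ ≤ t := le_max_left _ _
      have ht2 : t < T := max_lt ht₀T (by linarith)
      have ht3 : T - δ < t := lt_of_lt_of_le (by linarith) (le_max_right _ _)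
      exact hout t ⟨by linarith, ht2⟩ ht3 (mem_Kc_of_inW hWK (hinv t ⟨ht1, ht2⟩))
  obtain ⟨c, hc0, hc, hcU⟩ := hglob
  have hinv : ∀ t, t₀ ≤ t → InW WK (c t) := fun t ht =>
    inW_of_solution hr hWK (c := c) (a := t₀ - ε) (T := t + 1) (t₀ := t₀) (by linarith)
      (fun s hs => hc s hs.1) (fun s hs => hcU s hs.1) (by rw [hc0]; exact h0) t ⟨ht, by linarith⟩
  have hc' : ∀ t, t₀ ≤ t → HasDerivAt c (field r (c t)) t := fun t ht => hc t (by show t₀ - ε < t; linarith)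
  have hD : ∀ t, t₀ ≤ t → 0 < DW (c t).1 (c t).2 ∧ 0 < DZ (c t).1 (c t).2 := fun t ht =>
    ⟨by linarith [(DW_bounds hWK (hinv t ht)).1], by linarith [DZ_pos hWK (hinv t ht)]⟩
  -- exponential decay of `W`
  set κ : ℝ := (r - 1 / 24) / 2 with hκ
  have hdecay : ∀ t, t₀ ≤ t → (c t).1 ≤ p₀.1 * Real.exp (-κ * (t - t₀)) := by
    intro t ht
    -- `v s = W(s) e^{κ (s - t₀)}` is antitone on `[t₀, t]`
    have hexp : ∀ s, HasDerivAt (fun s => Real.exp (κ * (s - t₀))) (Real.exp (κ * (s - t₀)) * κ) s := by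
      intro s
      have h1 : HasDerivAt (fun s => κ * (s - t₀)) κ s := by
        simpa using ((hasDerivAt_id s).sub_const t₀).const_mul κ
      exact h1.exp
    have hv : ∀ s, t₀ ≤ s → HasDerivAt (fun s => (c s).1 * Real.exp (κ * (s - t₀)))
        ((field r (c s)).1 * Real.exp (κ * (s - t₀)) + (c s).1 * (Real.exp (κ * (s - t₀)) * κ)) s :=
      fun s hs => (hasDerivAt_fst (hc' s hs)).mul (hexp s)
    have hanti : AntitoneOn (fun s => (c s).1 * Real.exp (κ * (s - t₀))) (Icc t₀ t) := by
      apply antitoneOn_of_deriv_nonpos (convex_Icc _ _)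
      · exact fun s hs => (hv s hs.1).continuousAt.continuousWithinAt
      · rw [interior_Icc]; exact fun s hs => (hv s hs.1.le).differentiableAt.differentiableWithinAt
      · rw [interior_Icc]; intro s hs
        rw [(hv s hs.1.le).deriv]
        have h1 := field_fst_le hWK hr1 (hinv s hs.1.le)
        have h3 := Real.exp_pos (κ * (s - t₀))
        have key : (field r (c s)).1 + (c s).1 * κ ≤ 0 := by simp only [hκ]; linarith
        have e : (field r (c s)).1 * Real.exp (κ * (s - t₀)) + (c s).1 * (Real.exp (κ * (s - t₀)) * κ)
            = Real.exp (κ * (s - t₀)) * ((field r (c s)).1 + (c s).1 * κ) := by ring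
        rw [e]
        exact mul_nonpos_of_nonneg_of_nonpos h3.le key
    have key := hanti ⟨le_rfl, ht⟩ ⟨ht, le_rfl⟩ ht
    simp only [sub_self, mul_zero, Real.exp_zero, mul_one] at key
    rw [hc0] at key
    have h3 := Real.exp_pos (κ * (t - t₀))
    have e : Real.exp (-κ * (t - t₀)) * Real.exp (κ * (t - t₀)) = 1 := by
      rw [← Real.exp_add]; simp
    calc (c t).1 = (c t).1 * Real.exp (κ * (t - t₀)) * Real.exp (-κ * (t - t₀)) := by
          rw [mul_assoc, mul_comm (Real.exp _), e, mul_one]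
      _ ≤ p₀.1 * Real.exp (-κ * (t - t₀)) := by
          apply mul_le_mul_of_nonneg_right key (Real.exp_pos _).le
  refine ⟨c, hc0, hc', hinv, hD, hdecay, ?_⟩
  -- convergence to `P_∞`
  rw [tendsto_zero_iff_norm_tendsto_zero]
  have hbound : ∀ t, t₀ ≤ t → ‖c t‖ ≤ 3 / 2 * p₀.1 * Real.exp (-κ * (t - t₀)) := by
    intro t ht
    obtain ⟨k1, k2, k3, k4⟩ := hinv t ht
    have hW := hdecay t ht
    rw [Prod.norm_def, Real.norm_eq_abs, Real.norm_eq_abs]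
    have h3 := Real.exp_pos (-κ * (t - t₀))
    apply max_le
    · rw [abs_of_pos k1]; nlinarith
    · exact abs_le.mpr ⟨by nlinarith, by nlinarith⟩
  have hlim : Tendsto (fun t => 3 / 2 * p₀.1 * Real.exp (-κ * (t - t₀))) atTop (𝓝 0) := by
    have hκ0 : 0 < κ := by simp only [hκ]; linarith
    have h1 : Tendsto (fun t => -κ * (t - t₀)) atTop atBot := by
      have : Tendsto (fun t => t - t₀) atTop atTop := tendsto_atTop_add_const_right _ _ tendsto_id
      exact this.const_mul_atTop_of_neg (by linarith)
    have h2 := Real.tendsto_exp_atBot.comp h1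
    simpa using h2.const_mul (3 / 2 * p₀.1)
  apply tendsto_of_tendsto_of_tendsto_of_le_of_le' tendsto_const_nhds hlim
  · exact Eventually.of_forall fun t => norm_nonneg _
  · filter_upwards [eventually_ge_atTop t₀] with t ht using hbound t ht

end Wedge

end Monatomic

end BuckmasterCaolaboraGomezserrano2025

end Literature.Analysis.FluidPDE
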